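import Summits.QuantumFields.YangMills.Theorems.BalabanUVNodesPortS1JacKStepBridge
import Summits.QuantumFields.YangMills.Theorems.BalabanUVNodesPortS1JacobianHoloCov
import Literature.MathematicalPhysics.QuantumFieldTheory.Balaban1983to89.B15AveragingHolomorphicTowerRegion

/-!
# NODE O port PT-A — TOWER LOOP-SMALLNESS OF A COMPLEX FIELD FROM A SMALL-READS SPLICE OF ONE OF ITS `SU(2)` GAUGE TRANSFORMS: `k`-fold gauge covariance of the holomorphic iterate (PTZ-1's
# `avgMh_gauge` iterated), two-block locality on the saturated tower region (dag-n12-c), unitary conjugation, and the bridge `towerBridge_of_reads`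

Cell `ym-nodeO-ideate`, porter seat `ymgap-nodeO-port-PTA-1` (gen 6); proof file, `--supports stmt-QuantumFields-27930`.  [I] = [Balaban1987RG1], [B7] = [Balaban1985Averaging].  Toward
`stub_LZjacKStep` (`JacKStep F`): what remains after this file is the CONSTRUCTION, from `TowerSmallField` data ((i)(ii)(iii) on the tower region), of the `SU(2)` axial gauge `u` of the region and
of the splice `W` with small reads (dag-n13-w2's `N12SmallFieldAxialGaugeOfBackground.exists_isGaugeOn_dist1_le_of_plaqSmallOn` on the two-block box; needs ≥ 3 blocks per direction, i.e. the
`Mth` of `JacKStep`).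
CONTENTS (theorems only; `M₂(ℂ)` with the `L²`-operator norm).
* §1 ★ `iterMh_gauge` (`iterMh j (𝐕^u) = (iterMh j 𝐕)^{u ∘ toFine j}` for `det u = 1`, EVERY field), `loopMh_iterMh_gauge`, `norm_adjugate_mul_mul_sub_one_le` (`‖g^adj N g − 1‖ ≤ ‖N − 1‖`, `g ∈ SU(2)`).
* §2 ★★★ `towerLoops_of_gauged_splice` — `𝐕` any fine field, `u` `SU(2)`-valued, `W` a `det = 1` units field with `‖W − 1‖ ≤ s₀` everywhere and `6400ℓ²Lᵏs₀ ≤ 1` agreeing with `𝐕^u` on the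
  fine bonds of the tower region of `c` (`k + 1 ≤ m + K`) ⟹ `‖loopMh (iterMh j 𝐕) c′ i − 1‖ ≤ 120ℓ²Lᵏs₀` for all `j ≤ k`, `c′` a level-`(j+1)` bond of the region, all `i`.

HONEST FRAMING.  Bookkeeping∕algebra over landed theorems (★19200-p2's bound through `…JacKStepBridge`, PTZ-1's `…JacobianHoloCov`, dag-n12-c's locality); NOTHING of Bałaban asserted or
re-proved; `stub_LZjacKStep` ∕ `stub_LZjacDom` OPEN; 27930 OPEN · no claim; K0⁷∕K-Ax OPEN; NODE O 0∕1; COUNT 8∕28 · K 1∕4 UNMOVED; finite `𝕋⁴_{L^K}` at fixed ε — NOT continuum ∕ OS ∕ Clay;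
**the Yang–Mills mass gap is NOT proved by any of this.**  No `sorry`, no `def`, no `instance`, no `notation`; standard axioms.
-/

noncomputable section

open scoped BigOperators Matrix.Norms.L2Operator Topology

namespace Summit.QuantumFields.YangMills.Theorems.BalabanUVNodesPortS1

open Summit.QuantumFields.YangMills.Theorems.K0RecordFormatNames
open Literature.MathematicalPhysics.QuantumFieldTheory.Balaban1983to89
open Literature.MathematicalPhysics.QuantumFieldTheory.Balaban1983to89.Node00
open Literature.MathematicalPhysics.QuantumFieldTheory.Balaban1983to89.T4Continuum (walk Letter LStep loopWord)
open Literature.MathematicalPhysics.QuantumFieldTheory.Balaban1983to89.BlockAveraging (Idx off)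
open Literature.MathematicalPhysics.QuantumFieldTheory.Balaban1983to89.B10Eq42TorusConstraint (bondsIn)
open Literature.MathematicalPhysics.QuantumFieldTheory.Balaban1983to89.B15AveragingHolomorphic
  (holMh stepMh loopMh axialMh corrMh avgMh iterMh holMh_nil holMh_cons iterMh_zero iterMh_succ)
open _root_.Matrix

/-! ## §1  `k`-fold gauge covariance of the holomorphic iterate and unitary conjugation -/

section Covariance

variable {P : Params}

/-- **`k`-FOLD COVARIANCE OF THE HOLOMORPHIC ITERATE** under a `det = 1` fine gauge transformation `u`: `iterMh j (𝐕^u) = (iterMh j 𝐕)^{u ∘ toFine j}` (PTZ-1's one-step `avgMh_gauge`, iterated; the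
coarse transformation reads `u` at the representative fine site `toFine j`). [cite: Balaban1985Averaging, (11)–(12) p.19; Balaban1987RG1, (0.4) p.253] -/
theorem iterMh_gauge (u : Site P 0 → MatA 2) (hu : ∀ x, (u x).det = 1) (V : PBond P 0 → MatA 2) :
    ∀ j : ℕ, iterMh j (fun b : PBond P 0 => u b.src * V b * (u b.tgt).adjugate) =
      fun e : PBond P j => u (B10Eq38TorusDomains.toFine j e.src) * iterMh j V e * (u (B10Eq38TorusDomains.toFine j e.tgt)).adjugate
  | 0 => by funext e; simp
  | j + 1 => by
    funext e
    rw [iterMh_succ, iterMh_gauge u hu V j, iterMh_succ]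
    exact avgMh_gauge (fun x : Site P j => u (B10Eq38TorusDomains.toFine j x)) (fun x => hu _) (iterMh j V) e

/-- The (0.4) loop matrices of the iterate of a gauge transform are the conjugates of those of the iterate. [cite: Balaban1985Averaging, (11)–(12) p.19; Balaban1987RG1, (0.4) p.253] -/
theorem loopMh_iterMh_gauge (u : Site P 0 → MatA 2) (hu : ∀ x, (u x).det = 1) (V : PBond P 0 → MatA 2) (j : ℕ) (c : PBond P (j + 1)) (i : Idx P) :
    loopMh (iterMh j (fun b : PBond P 0 => u b.src * V b * (u b.tgt).adjugate)) c i =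
      u (B10Eq38TorusDomains.toFine j (emb c.src)) * loopMh (iterMh j V) c i * (u (B10Eq38TorusDomains.toFine j (emb c.src))).adjugate := by
  rw [iterMh_gauge u hu V j]
  exact loopMh_gauge (fun x : Site P j => u (B10Eq38TorusDomains.toFine j x)) (fun x => hu _) (iterMh j V) c i

/-- Undoing a special-unitary conjugation does not increase the distance to `1`: `‖M − 1‖ ≤ ‖g M g^adj − 1‖`… stated as `‖g^adj N g − 1‖ ≤ ‖N − 1‖` for `g ∈ SU(2)`. [folklore] -/
theorem norm_adjugate_mul_mul_sub_one_le (g : MatA 2) (hg : g ∈ Matrix.specialUnitaryGroup (Fin 2) ℂ) (N : MatA 2) :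
    ‖g.adjugate * N * g - 1‖ ≤ ‖N - 1‖ := by
  have hdet : g.det = 1 := (Matrix.mem_specialUnitaryGroup_iff.1 hg).2
  have hU : g ∈ Matrix.unitaryGroup (Fin 2) ℂ := (Matrix.mem_specialUnitaryGroup_iff.1 hg).1
  have hadj : g.adjugate * g = 1 := by rw [adjugate_mul, hdet, one_smul]
  have hstar : g.adjugate = star g := by
    have h1 : star g * g = 1 := Matrix.mem_unitaryGroup_iff'.1 hU
    calc g.adjugate = g.adjugate * (g * star g) := by rw [Matrix.mem_unitaryGroup_iff.1 hU, mul_one]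
      _ = star g := by rw [← mul_assoc, hadj, one_mul]
  have e : g.adjugate * N * g - 1 = g.adjugate * (N - 1) * g := by
    rw [mul_sub, sub_mul, mul_one, hadj]
  rw [e]
  calc ‖g.adjugate * (N - 1) * g‖ ≤ ‖g.adjugate * (N - 1)‖ * ‖g‖ := norm_mul_le _ _
    _ ≤ ‖N - 1‖ * 1 := by
      gcongr
      · rw [hstar]; exact le_of_eq (CStarRing.norm_mem_unitary_mul (N - 1) (Unitary.star_mem hU))
      · exact le_of_eq (CStarRing.norm_coe_unitary ⟨g, hU⟩)
    _ = ‖N - 1‖ := mul_one _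

end Covariance

/-! ## §2  ★★★ Tower loop-smallness of a field from a small-reads splice of one of its `SU(2)` gauge transforms -/

section Tower

variable {P : Params}

/-- ★★★ **TOWER LOOP-SMALLNESS FROM A GAUGED SMALL-READS SPLICE.**  Let `𝐕` be a complex fine field, `u` an `SU(2)`-valued fine gauge transformation, and `W` a `det = 1` units field with
`‖W(b) − 1‖ ≤ s₀` at EVERY bond (budget `6400ℓ²Lᵏs₀ ≤ 1`) that AGREES WITH `𝐕^u` on the fine bonds of the tower region of a level-`(k+1)` bond `c`.  Then for every `j ≤ k`, every
level-`(j+1)` bond `c′` of the region and every index: `‖loopMh (iterMh j 𝐕) c′ i − 1‖ ≤ 120ℓ²Lᵏs₀` (the bridge `towerBridge_of_reads`, two-block locality of the iterate on the saturated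
region, `k`-fold covariance, unitary conjugation). [cite: Balaban1987RG1, p.263 L8–10, (0.4) p.253; Balaban1985Averaging, Prop. 2 (54) p.26, (11)–(12) p.19] -/
theorem towerLoops_of_gauged_splice {k : ℕ} (hk : k + 1 ≤ P.m + P.K) (c : PBond P (k + 1)) (V : PBond P 0 → MatA 2)
    (u : Site P 0 → MatA 2) (hu : ∀ x, u x ∈ Matrix.specialUnitaryGroup (Fin 2) ℂ)
    (W : GaugeField P 0 (MatA 2)ˣ) (hdet : ∀ b, ((W b : (MatA 2)ˣ) : MatA 2).det = 1)
    {s₀ : ℝ} (hs₀ : 0 ≤ s₀) (hW : ∀ b, ‖((W b : (MatA 2)ˣ) : MatA 2) - 1‖ ≤ s₀)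
    (hbudget : 6400 * (((P.d + 2) * P.L : ℕ) : ℝ) ^ 2 * (P.L : ℝ) ^ k * s₀ ≤ 1)
    (hagree : ∀ b : PBond P 0, b ∈ bondsIn 0 (B14.Eq22Determines.blockIter (k + 1) ⁻¹' ({c.src, c.tgt} : Set (Site P (k + 1)))) →
      ((W b : (MatA 2)ˣ) : MatA 2) = u b.src * V b * (u b.tgt).adjugate) :
    ∀ j : ℕ, j ≤ k → ∀ c' : PBond P (j + 1), c' ∈ bondsIn (j + 1) (B14.Eq22Determines.blockIter (k + 1) ⁻¹' ({c.src, c.tgt} : Set (Site P (k + 1)))) →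
      ∀ i : Idx P, ‖loopMh (iterMh j V) c' i - 1‖ ≤ 120 * (((P.d + 2) * P.L : ℕ) : ℝ) ^ 2 * (P.L : ℝ) ^ k * s₀ := by
  intro j hj c' hc' i
  set Y : Set (Site P 0) := B14.Eq22Determines.blockIter (k + 1) ⁻¹' ({c.src, c.tgt} : Set (Site P (k + 1))) with hY
  have hudet : ∀ x, (u x).det = 1 := fun x => (Matrix.mem_specialUnitaryGroup_iff.1 (hu x)).2
  have hsat := B15AveragingHolomorphicTowerRegion.preimage_blockIter_saturated hk ({c.src, c.tgt} : Set (Site P (k + 1)))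
  -- (1) the bridge: loops of the iterate of the splice are small everywhere
  obtain ⟨-, -, -, hloopW⟩ := towerBridge_of_reads (Nat.le_of_succ_le hk) W hdet hs₀ hW hbudget j hj
  -- (2) locality: on the region the iterate of the splice is the iterate of the gauge transform
  have hjK : j ≤ P.m + P.K := hj.trans (Nat.le_of_succ_le hk)
  have hj1 : j + 1 ≤ P.m + P.K := by omega
  have hiter : ∀ e : PBond P j, e ∈ bondsIn j Y →
      iterMh j (fun b => ((W b : (MatA 2)ˣ) : MatA 2)) e = iterMh j (fun b : PBond P 0 => u b.src * V b * (u b.tgt).adjugate) e :=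
    B15AveragingHolomorphicLocal.iterMh_apply_congr_of_eqOn_bondsIn j hjK (fun j' hj' => hsat j' (by omega)) (fun b hb => hagree b hb)
  have hloop_eq : loopMh (iterMh j (fun b => ((W b : (MatA 2)ˣ) : MatA 2))) c' i =
      loopMh (iterMh j (fun b : PBond P 0 => u b.src * V b * (u b.tgt).adjugate)) c' i := by
    rw [B10Eq42TorusConstraint.mem_bondsIn_iff] at hc'
    refine B15AveragingHolomorphicLocal.loopMh_congr₂ hj1 c' (fun b h₁ h₂ => hiter b ?_) i
    rw [B10Eq42TorusConstraint.mem_bondsIn_iff]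
    have hblk : ∀ x : Site P j, (blockOf x = c'.src ∨ blockOf x = c'.tgt) → B10Eq38TorusDomains.toFine j x ∈ Y := by
      intro x hx
      refine (hsat j (by omega) x).2 ?_
      rcases hx with h | h
      · rw [h]; exact hc'.1
      · rw [h]; exact hc'.2
    exact ⟨hblk _ h₁, hblk _ h₂⟩
  -- (3) covariance + unitary conjugation
  have hcov := loopMh_iterMh_gauge u hudet V j c' i
  have h := hloopW c' i
  rw [hloop_eq, hcov] at h
  set g : MatA 2 := u (B10Eq38TorusDomains.toFine j (emb c'.src)) with hg
  have hgSU : g ∈ Matrix.specialUnitaryGroup (Fin 2) ℂ := hu _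
  have hga : g.adjugate * g = 1 := by rw [adjugate_mul, (Matrix.mem_specialUnitaryGroup_iff.1 hgSU).2, one_smul]
  have e : loopMh (iterMh j V) c' i = g.adjugate * (g * loopMh (iterMh j V) c' i * g.adjugate) * g := by
    calc loopMh (iterMh j V) c' i = (g.adjugate * g) * loopMh (iterMh j V) c' i * (g.adjugate * g) := by rw [hga, one_mul, mul_one]
      _ = g.adjugate * (g * loopMh (iterMh j V) c' i * g.adjugate) * g := by noncomm_ring
  rw [e]
  exact (norm_adjugate_mul_mul_sub_one_le g hgSU _).trans h

end Tower

end Summit.QuantumFields.YangMills.Theorems.BalabanUVNodesPortS1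

end
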